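import Mathlib
import Summits.ValiantsHypothesis.ValiantsHypothesis.Theorems.FifoMatchingNNNotVPTokenGameMatching
import Summits.ValiantsHypothesis.ValiantsHypothesis.Theorems.FifoMatchingNNNotVPRoundStructure
import HarnessLib

/-!
# Route FifoMatching — crux `NNNotVP` (stmt-ValiantsHypothesis-11615), line `division_split`:
# TOKEN PROGRAMS — every labelled round program is a monotone projection of NFPM-existence

Seal of the token-game framework (`…TokenGame`, `…TokenGameMatching`, `…RoundStructure`; design
record of the clique gadget for stub A `stub_supportFnHard` in the docstring of `…TokenGame`).
A (token) PROGRAM with `k` tokens, `R ≥ 1` rounds and position space `Fin N` is a labelling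
`lab₀ : Fin k → Fin N → β ⊕ Bool` (round `0`: token `i` enters position `q` along an arc labelled
`lab₀ i q`) and `lab : Fin R → Fin N → Fin N → β ⊕ Bool` (round `j+1 < R`: a token moves from `q` to
`q'` along an arc labelled `lab j q q'`); `Sum.inr false` = no arc, `Sum.inr true` = free arc,
`Sum.inl b` = arc switched by the input bit `y b`.  A RUN of the program on input `y : β → Bool`
is a family of increasing (`=` non-crossing) position maps `p j : Fin k → Fin N` with all the
labels met switched on.

* `exists_programProjection` — for every program there is a projection
  `e : σ n → β ⊕ Bool`, `n = k + R N`, such that for EVERY input `y`, nest-free perfect-matching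
  existence on the arc vector `Sum.elim y id ∘ e` (the Boolean function of stub A) holds iff the
  program has a run on `y`.

With `β = KEdge m` this is exactly the shape consumed by `supportFnHard_of_cliqueProjection_seq`:
stub A now follows from a program (poly size in `m`) that has a run on every `⌊√m⌋`-clique vector
and none on any `(⌊√m⌋-1)`-colouring vector — the clique program of the design record.

Honest framing: a reduction; the clique program is NOT written here, stubs Z / A / B2, the crux
`NNNotVP` and `VP ≠ VNP` stay OPEN (NOT proved).  No definitions, no named facts.
-/

noncomputable section

-- Sub = Summit single-conjunct layout: the duplicated namespace component is mandated by the tree.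
set_option linter.dupNamespace false

namespace Summit.ValiantsHypothesis.ValiantsHypothesis.Theorems.FifoMatching.NNNotVP.DivisionSplit

open Finset
open scoped Classical

/-- **Every token program is a monotone projection of nest-free perfect-matching existence.**
For labels `lab₀ : Fin k → Fin N → β ⊕ Bool`, `lab : Fin R → Fin N → Fin N → β ⊕ Bool` (`0 < R`)
there is `e : σ (k + R N) → β ⊕ Bool` such that for every input `y : β → Bool`:
`NFPM (Sum.elim y id ∘ e)` iff there are increasing `p j : Fin k → Fin N` (`j < R`) with
`lab₀ i (p 0 i)` and `lab j (p j i) (p (j+1) i)` (`j + 1 < R`) switched on. [folklore] -/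
theorem exists_programProjection (β : Type*) (k R N : ℕ) (hR : 0 < R)
    (lab₀ : Fin k → Fin N → β ⊕ Bool) (lab : Fin R → Fin N → Fin N → β ⊕ Bool) :
    ∃ e : σ (k + R * N) → β ⊕ Bool, ∀ y : β → Bool,
      (decide (SuppFn (NN (k + R * N))
          (univ.filter fun a => Sum.elim y id (e a) = true)) = true ↔
        ∃ p : Fin R → Fin k → Fin N, (∀ j, StrictMono (p j)) ∧
          (∀ i, Sum.elim y id (lab₀ i (p ⟨0, hR⟩ i)) = true) ∧
          ∀ (j : Fin R) (h : j.val + 1 < R) (i : Fin k),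
            Sum.elim y id (lab j (p j i) (p ⟨j.val + 1, h⟩ i)) = true) := by
  obtain ⟨first, act, tok, last, lay, dec, hmono, h0, hA, hT, hL, hfirst, hact, htok, hlast,
    dF, dA, dT, dL, hcov⟩ := exists_roundStructure k R N
  -- the label of an ordered pair of decoded positions
  let E : (Fin k ⊕ ((Fin R × Fin N) ⊕ ((Fin R × Fin N) ⊕ Fin k))) →
      (Fin k ⊕ ((Fin R × Fin N) ⊕ ((Fin R × Fin N) ⊕ Fin k))) → β ⊕ Bool := fun c d =>
    match c, d with
    | Sum.inl i, Sum.inr (Sum.inl jq) => if jq.1.val = 0 then lab₀ i jq.2 else Sum.inr false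
    | Sum.inr (Sum.inl jq), Sum.inr (Sum.inr (Sum.inl jq')) =>
        if jq = jq' then Sum.inr true else Sum.inr false
    | Sum.inr (Sum.inr (Sum.inl jq)), Sum.inr (Sum.inl jq') =>
        if jq.1.val + 1 = jq'.1.val then lab jq.1 jq.2 jq'.2 else Sum.inr false
    | Sum.inr (Sum.inr (Sum.inl jq)), Sum.inr (Sum.inr (Sum.inr _)) =>
        if jq.1.val + 1 = R then Sum.inr true else Sum.inr false
    | _, _ => Sum.inr false
  refine ⟨fun a => E (dec a.1) (dec a.2), fun y => ?_⟩
  -- coverage in the framework's form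
  have hcov' : ∀ a, (∃ i, a = first i) ∨ (∃ j q, a = act j q) ∨ (∃ j q, a = tok j q) ∨
      (∃ i, a = last i) := by
    intro a
    have ha := hcov a
    rcases hd : dec a with i | ⟨j, q⟩ | ⟨j, q⟩ | i <;> rw [hd] at ha
    · exact Or.inl ⟨i, ha⟩
    · exact Or.inr (Or.inl ⟨j, q, ha⟩)
    · exact Or.inr (Or.inr (Or.inl ⟨j, q, ha⟩))
    · exact Or.inr (Or.inr (Or.inr ⟨i, ha⟩))
  have hRR : R - 1 + 1 = R := by omega
  rw [nfpmExists_iff_tokenPaths hR hmono h0 hA hT hL hfirst hact htok hlast hcov'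
    (fun a => Sum.elim y id (E (dec a.1) (dec a.2)))]
  · -- the two run conditions coincide
    have e0 : ∀ i q, E (dec (first i)) (dec (act ⟨0, hR⟩ q)) = lab₀ i q := by
      intro i q
      simp [dF, dA, E]
    have eS : ∀ (j : Fin R) (h : j.val + 1 < R) q q',
        E (dec (tok j q)) (dec (act ⟨j.val + 1, h⟩ q')) = lab j q q' := by
      intro j h q q'
      simp [dT, dA, E]
    simp only [e0, eS]
  · -- arcs out of `first`
    intro i b hb hx
    have hb' := hcov b
    rcases hd : dec b with i' | ⟨j, q⟩ | ⟨j, q⟩ | i' <;> rw [hd] at hb' <;>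
      simp only [dF, hd, E] at hx
    · exact absurd hx (by simp)
    · by_cases hj : j.val = 0
      · have : j = ⟨0, hR⟩ := Fin.ext hj
        subst this
        exact ⟨q, hb'⟩
      · rw [if_neg hj] at hx
        exact absurd hx (by simp)
    · exact absurd hx (by simp)
    · exact absurd hx (by simp)
  · -- arcs out of `act j q`
    intro j q b hb hx
    have hb' := hcov b
    rcases hd : dec b with i' | ⟨j', q'⟩ | ⟨j', q'⟩ | i' <;> rw [hd] at hb' <;>
      simp only [dA, hd, E] at hx
    · exact absurd hx (by simp)
    · exact absurd hx (by simp)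
    · by_cases hjq : (j, q) = (j', q')
      · obtain ⟨rfl, rfl⟩ := Prod.mk.injEq _ _ _ _ ▸ hjq
        exact hb'
      · rw [if_neg hjq] at hx
        exact absurd hx (by simp)
    · exact absurd hx (by simp)
  · -- arcs out of `tok j q`
    intro j q b hb hx
    have hb' := hcov b
    rcases hd : dec b with i' | ⟨j', q'⟩ | ⟨j', q'⟩ | i' <;> rw [hd] at hb' <;>
      simp only [dT, hd, E] at hx
    · exact absurd hx (by simp)
    · by_cases hj : j.val + 1 = j'.val
      · left
        have h : j.val + 1 < R := by have := j'.isLt; omega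
        have : j' = ⟨j.val + 1, h⟩ := Fin.ext hj.symm
        subst this
        exact ⟨h, q', hb'⟩
      · rw [if_neg hj] at hx
        exact absurd hx (by simp)
    · exact absurd hx (by simp)
    · by_cases hj : j.val + 1 = R
      · exact Or.inr ⟨hj, i', hb'⟩
      · rw [if_neg hj] at hx
        exact absurd hx (by simp)
  · -- no arc out of `last`
    intro i b hb hx
    have hb' := hcov b
    rcases hd : dec b with i' | ⟨j', q'⟩ | ⟨j', q'⟩ | i' <;>
      simp only [dL, hd, E] at hx <;> exact absurd hx (by simp)
  · -- twin arcs are free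
    intro j q
    simp [dA, dT, E]
  · -- final arcs are free
    intro q i
    simp [dT, dL, E, hRR]

end Summit.ValiantsHypothesis.ValiantsHypothesis.Theorems.FifoMatching.NNNotVP.DivisionSplit

end
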